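import Mathlib
import Literature.MathematicalPhysics.QuantumFieldTheory.Balaban1983to89.B12Sec2to5

/-!
# `Balaban1983to89.B12CondIIIJ` — T. Bałaban, *Renormalization group approach to lattice gauge field theories. I.
Generation of effective actions in a small field approximation and a coupling constant renormalization in four
dimensions*, Commun. Math. Phys. **109**, 249–301 (1987) [Balaban1987RG1], **§3 pp. 278–280 [PDF 30–32]: the J-half
("second inequality", |𝐉| < γ₀ = α₀) of condition (iii) for the composite configuration of Lemma 4 (3.53)** — a NEW
satellite leaf of `…Balaban1983to89.B12Sec2to5` (§3: `Lemma4Frame`, `Lemma4Consts`, `Lemma4Restrictions`, `scale_sq_le`,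
`ineq351`, `ineq352_closes`); it imports that module only and modifies nothing.

CITATION HEADER (lean-in-tree rule 2026-08-18; PDF held `paper:balaban1987-cmp109-rg-i-small-field`, PDF page = journal
page − 248; renders `b2b-balaban-ref1/pages/1987-cmp109-rg-I-small-field/1987-cmp109-rg-I-small-field-pNNN-x2.png`,
NNN = 014, 015, 029, 030, 031, 032, read as images by the typing unit `b2b-balaban-b12-g13`).  THE PRINTED LOCI, verbatim:
* p. 262 [14], definition of the space U^c_j(X, α₀, α₁, γ₀): *"(iii) The configurations 𝐔, 𝐉 satisfy the bounds
  |∂𝐔 − 1| < α₀ξ², |𝐉| < γ₀ on X. (1.14)"*; p. 263 [15]: *"Usually we consider spaces with γ₀ = α₀, and then we omit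
  the constant γ₀ from the symbol denoting the space."* — so for the target space U^c_j(X, α₀, α₁) of (3.36)/(3.53) the
  SECOND inequality of (iii) reads |𝐉| < α₀.
* p. 277 [29]: *"We have to prove that (U_j(□₀, exp iτB), J_j(□₀, exp iτB))|_X ∈ U^c_j(X, α₀, α₁) (3.36) for all 𝐔, 𝐉, 𝐀
  in the above spaces, and for the parameters τ in the interval [0, 1]."*; *"|𝐇_j(□₀, τQ(…))|, |∇^ξ𝐇_j(□₀, τQ(…))| <
  B₃²O(1)Mα₀L^{j−1}η on □̃³, |u_j − 1| < B₃²O(1)Mα₀. (3.37)"*; *"… the orbit of the configuration U_j(□₀, …) above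
  contains the configuration exp iξ𝐇_j(…) satisfying the conditions (i), (ii) on the cube □̃³, hence on X. We will prove
  that this configuration satisfies all the conditions (i)–(iv)."*
* p. 278 [30]: *"|∂U_{k+1}(□₀, M˙(𝐔)) − 1| < (1+2β)α₀(L⁻¹η)², |J_{k+1}(□₀, M˙(𝐔))| < (1+2β)α₀ on □̃³. (3.40)"*; (3.41)
  *"… < (1+3β)α₀(L^{j−1}η)²ξ² on □̃³, (3.41) for α₁ sufficiently small, e.g. O(1)Mα₁ ≤ β. A similar inequality holds
  for the expression replacing the variable 𝐉  |D^{ξ*}_{exp iξ𝐇_j(…)}ξ⁻²π Im ∂ exp iξ𝐇_j(…)| = |R((vū_{k+1}v_ju_j)⁻¹)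
  (L^{j−1}η)³J_{k+1}(M˙(𝐔))| < (1+3β)α₀(L^{j−1}η)³ on □̃³. (3.42) From the bounds in (3.37), and an elementary
  inequality, we get |∂ exp iξ𝐇_j(…) − 1 − iξ²(∂^ξ𝐇_j(…))| ≤ ½(∂|𝐇_j(…)|)²ξ² exp ∂ξ|𝐇_j(…)| < 8(B₃²O(1)Mα₀L^{j−1}η)²ξ²
  exp 4B₃²O(1)Mα₀L⁻¹η < (4B₃²O(1)M)²α₀²(L^{j−1}η)²ξ² on □̃³. (3.43) We assume that (4B₃²O(1)M)²α₀ ≤ β. This second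
  restriction is not essentially stronger than the first one, because we have already assumed the restriction
  O(1)Mα₁ ≤ β on α₁."*
* p. 279 [31]: *"The above inequality and (3.41) yield |∂^ξ𝐇_j(□₀, Q(L⁻¹η𝐇_{k+1}))| < (1+4β)α₀(L^{j−1}η)² on □̃³.
  (3.44)"*; *"|∂^ξ𝐇_j(□₀, Q(L⁻¹η𝐇_{k+1})) − ∂^ξH_{1,j}Q(L⁻¹η𝐇_{k+1})| < B₃(B₃O(1)Mα₀L^{j−1}η)² < βα₀(L^{j−1}η)² on □̃³.
  (3.45) … Thus finally we obtain |∂^ξH_{1,j}Q(L⁻¹η𝐇_{k+1})| < (1+5β)α₀(L^{j−1}η)² on □̃³. (3.46) This inequality is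
  linear in Q(…), hence it is valid also for this expression replaced by τQ(…), τ ∈ [0, 1]. From the above
  considerations it is obvious that we can reverse the arguments, thus we obtain (3.44) with τQ(…), and the factor
  1+6β on the right-hand side. Similarly, the inequality (3.43) yields |∂ exp iξ𝐇_j(□₀, τQ(L⁻¹η𝐇_{k+1}))| <
  (1+7β)α₀(L^{j−1}η)²ξ² on □̃³. (3.47)"* [sic: "− 1" missing inside |·|] *"Let us notice that j ≤ k, hence L^jη ≤ 1
  and (1+7β)L⁻² ≤ 1 for β not too large. The above inequality is the required first inequality in the condition (iii).
  The second inequality in this condition is obtained in the same way. We start with (3.42) and we use again the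
  formulas and the bounds (1.43)–(1.54) [14]. They give a bound of the type (3.44), but for the second order operator
  ∂^{ξ*}∂^ξ. Then the same reasoning as between (3.44)–(3.47) gives the required second inequality in (iii)."*
* p. 280 [32]: *"|𝐀₂|, |∇^ξ𝐀₂| ≤ B₃|B′| < B₃α₃,"*; *"|∂^ξ𝐇_j(□₀, τQ(L⁻¹η𝐇_{k+1}) + B′)| ≤ |∂^ξ𝐇_j(□₀, τQ(L⁻¹η𝐇_{k+1}))| +
  |∂^ξ𝐀₂| < (1+6β)α₀(L^{j−1}η)² + 2B₃α₃ ≤ (1+6β)L⁻²α₀ + 2B₃α₃ ≤ (1+7β)L⁻²α₀ on □̃³, (3.51)"* [sic: the print,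
  display (3.51) line 2, has a stray second «)», «≦(1+6β))L⁻²α₀» — render p032 re-read as image; normalised here] *"where we have assumed
  2B₃α₃ ≤ βL⁻²α₀. The above inequality, and the inequality (3.43) slightly modified for the present situation, give
  the bound |∂ exp iξ𝐇_j(□₀, τQ(L⁻¹η𝐇_{k+1}) + B′) − 1| < (1+8β)L⁻²α₀ξ² on □̃³. (3.52) This implies the first
  inequality in the condition (iii). The second is proved in the same way, as it was already discussed."*

VERSION: v1 p184296 (unit `b2b-balaban-b12-g13`) → v1.1 (unit `b2b-balaban-b12-g14`) = DOCSTRINGS ONLY, after the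
cross-read `HOME/b2b-balaban-adv4/g39/XREAD-B12CondIIIJ-v1.md` (GAPS C-adv4-75, verdict ok-with-DOCFIX): A1 the [sic] on
(3.51)'s stray «)»; A2 the (§4) hedge — `no_x3_form` / `not_x3_budget` are facts about the (J1) shape typed here, not
about a printed display.  Every `theorem` statement and proof is byte-identical to v1.

WHAT THIS MODULE TYPES, and nothing else (schematic REAL arithmetic exactly as in `B12Sec2to5` §3 — DIVERGENCE
D-b03.1 / D-b12g13.1: every field quantity |∂^ξ𝐇_j(…)|, |𝐉(…)|, |∂^{ξ*}∂^ξ𝐀₂|, … is a real number carrying its bound as a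
HYPOTHESIS; the common factor ξ² of (3.41)/(3.43)/(3.47)/(3.52) is cancelled; x := L^{j−1}η):
(§1) the scaling gain of p. 279, x ≤ L⁻¹ (from *"j ≤ k, hence L^jη ≤ 1"*), and its powers;
(§2) the kernel-checked arithmetic of the DISPLAYED first-order ladder: (3.41) + (3.43) ⇒ (3.44) (factor 1+4β),
+ (3.45) ⇒ (3.46) (1+5β), the τ-reversal ⇒ *"(3.44) with τQ(…), and the factor 1+6β"*, + (3.43) ⇒ (3.47) (1+7β) — the
rungs BEFORE the two rungs `B12Sec2to5.ineq351` ((3.51), 1+7β with B′) / `B12Sec2to5.ineq352_closes` ((3.52) ⇒ (iii),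
1+8β) already check; plus the generic closing step (1 + cβ)L⁻²α₀ ≤ α₀ ⇐ 1 + cβ ≤ L² (*"for β not too large"*);
(§3) the J-LADDER = *"the same reasoning … for the second order operator ∂^{ξ*}∂^ξ"*, started at the PRINTED (3.42)
(scale x³, factor 1+3β) and run one derivative up with EVERY analytic input a hypothesis of a stated SHAPE —
(J1) the J-linearisation remainder |𝐉(exp iξ𝐇) − ∂^{ξ*}∂^ξ𝐇| ≤ C_N·α₀²·x² at B′ = 0 (quadratic in the (3.37)-size of
𝐇, the analogue of (3.43); C_N absolute — in print it would be absorbed into the generic O(1) of *"(4B₃²O(1)M)²α₀ ≤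
β"*, `resN_of_printed`) and (J1′) the same remainder at τQ(…) + B′ bounded by βL⁻²α₀ (the analogue of *"(3.43)
slightly modified for the present situation"*, the single β at the scale L⁻² by which (3.51)'s 1+7β becomes (3.52)'s
1+8β), (J2) the second-order-part bound of (3.45) for ∂^{ξ*}∂^ξ instead of ∂^ξ, (J3) a SECOND-derivative
bound |∂^{ξ*}∂^ξ𝐀₂| ≤ B₃″|B′| (p. 280 displays only the first-order |𝐀₂|, |∇^ξ𝐀₂| ≤ B₃|B′|; a bound of this shape is
what [Balaban1985Variational] (190) p. 308, entries 4–5 (tree `B11.pref190`; itself with an author-declared omitted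
proof, GAPS G-B11-G2), supplies for the generating kernel — a source the sentence under audit does not cite) — and CLOSED (`jLadder_bound`, `jBudget_lt`, `jHalf_closes`, `condIII_second_of_restrictions`):
|𝐉| < α₀ STRICTLY, for every τ ∈ [0, 1] and |B′| < α₃, under exactly the typed restriction list
`B12Sec2to5.Lemma4Restrictions` (which contains 0 < α₀, 0 < β, 1 < L, 1 + 8β ≤ L²) plus TWO restrictions of the
printed SHAPES that the printed list does not contain: B₃″α₃ ≤ βL⁻²α₀ (shape of *"2B₃α₃ ≤ βL⁻²α₀"*) and C_N·α₀ ≤ β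
(shape of *"(4B₃²O(1)M)²α₀ ≤ β"*).  The count of β's along the J-ladder is the SAME 1+8β as along the first-order
ladder; the start one scale lower supplies the strictness ((1+3β)α₀x³ ≤ (1+3β)L⁻¹α₀x² < (1+3β)α₀L⁻²);
(§4) a kernel fact ABOUT THE (J1) SHAPE TYPED HERE (`no_x3_form`, `not_x3_budget`) — not about a printed display
(v1.1 hedge, XREAD C-adv4-75 A2): IF the J-linearisation remainder has exactly the (3.43)-type shape C_N·α₀²·x²
(quadratic in the (3.37)-size α₀x of 𝐇, with no further small factor), THEN the promised intermediate *"bound of the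
type (3.44), but for the second order operator"* — an x³-SCALE bound |∂^{ξ*}∂^ξ𝐇_j(□₀, Q(…))| < (1+cβ)α₀(L^{j−1}η)³ —
is not what that mechanism gives one derivative up: fitting C_Nα₀²x² under βα₀x³ would need C_Nα₀ ≤ βx for EVERY
admissible x = L^{j−1}η ∈ (0, L⁻¹], which fails for k − j large (for every C > 0 there is an admissible x with
βx < Cα₀).  CAVEAT: the true shape of the J-remainder is NOT displayed in print — (3.42) carries the factor ξ⁻² (in
D^{ξ*}ξ⁻²π Im ∂) where (3.43) carries ξ², so the remainder one derivative up could carry an extra lattice factor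
(e.g. a further power of x), under which an x³-scale bound is NOT excluded by `not_x3_budget`; whether the printed
sentence is imprecise therefore depends on that undisplayed shape (GAPS G-adv2-28 (i), hedged the same way in
C-b12g14-1).  Either way harmless for (3.36)/(3.53), which need only |𝐉| < α₀ (§3 closes at the x²-scale with margin);
no consumer in [Balaban1987RG1] uses an x³-scale J-bound of the composite configuration (§4 consumes (3.36) through
membership only);
(§5) the conjunction with `B12Sec2to5.ineq352_closes`: both inequalities of condition (iii) for the composite
configuration under the enlarged restriction list (`condIII_both_of_restrictions`), and the remark that at τ = 1, B′ = 0
the printed (3.42) alone already gives |𝐉| < α₀ (`ineq342_closes`).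
Census rows: `HOME/GAPS.md` G-B12s-07 (surge reader: the J-half *"never displayed"*), G-adv2-28 / C-adv2-32 (hostile
re-derivation by the adversarial reader `b2b-balaban-adv2-g20`; second engine `HOME/b2b-balaban-adv2/g20/B12Iii2Arith.lean`,
farm rc 0, whose `J_half_closes` (there under β ≤ 1/8, L ≥ 2, B′-term ≤ α₀/4) and `no_x3_form` (there under L ≥ 2)
are RE-PROVED here under the printed restriction shapes and 1 < L), C-b12g13-1 (this module).
ABSOLUTE RULE.  Nothing of the series is asserted: the inputs (J1)–(J3) and every displayed bound enter ONLY as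
hypotheses of kernel-checked real-arithmetic theorems; no `def … : Prop` is introduced.  `[cite: …]` tags mark a PRINTED
display whose arithmetic the theorem checks; `[folklore]` tags mark elementary arithmetic about hypotheses that are
NOT displayed in print (all J-ladder rungs) — each docstring says which.  NOT summit progress: one located step of the
small-field analytic-extension lemma of one paper of the programme; nothing about Theorem 2's flow, the infinite volume
or the Clay problem.
-/

namespace Literature.MathematicalPhysics.QuantumFieldTheory.Balaban1983to89.B12CondIIIJ

open Literature.MathematicalPhysics.QuantumFieldTheory.Balaban1983to89

/-! ## §1  The scaling gain (p. 279 [31]: *"j ≤ k, hence L^jη ≤ 1"*), x := L^{j−1}η ≤ L⁻¹ -/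

/-- x = L^{j−1}η ≥ 0. [folklore] -/
theorem scale_nonneg {L η : ℝ} (j : ℕ) (hL : 0 < L) (hη : 0 ≤ η) : 0 ≤ L ^ (j - 1) * η :=
  mul_nonneg (pow_nonneg hL.le _) hη

/-- p. 279 [31]: for 1 ≤ j and L^jη ≤ 1, x = L^{j−1}η ≤ L⁻¹ (the un-squared form of `B12Sec2to5.scale_sq_le`).
[folklore] -/
theorem scale_le {L η : ℝ} {j : ℕ} (hL : 0 < L) (hη : 0 ≤ η) (hj : 1 ≤ j) (hscale : L ^ j * η ≤ 1) :
    L ^ (j - 1) * η ≤ L⁻¹ := by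
  have hLj : L ^ j = L * L ^ (j - 1) := by
    rw [← pow_succ']
    congr 1
    omega
  have h1 : L * (L ^ (j - 1) * η) ≤ 1 := by
    calc L * (L ^ (j - 1) * η) = L ^ j * η := by rw [hLj]; ring
      _ ≤ 1 := hscale
  have _hη := hη
  calc L ^ (j - 1) * η = L⁻¹ * (L * (L ^ (j - 1) * η)) := by
        rw [← mul_assoc, inv_mul_cancel₀ hL.ne', one_mul]
    _ ≤ L⁻¹ * 1 := mul_le_mul_of_nonneg_left h1 (inv_pos.mpr hL).le
    _ = L⁻¹ := mul_one _

/-- 0 ≤ x ≤ L⁻¹ ⇒ x² ≤ L⁻² (the printed gain *"(L^{j−1}η)² ≤ L⁻²"* of (3.51)). [folklore] -/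
theorem sq_le_of_scale {L x : ℝ} (hx0 : 0 ≤ x) (hx : x ≤ L⁻¹) : x ^ 2 ≤ L⁻¹ ^ 2 :=
  pow_le_pow_left₀ hx0 hx 2

/-- 0 ≤ x ≤ L⁻¹ ⇒ x³ ≤ L⁻¹·x² (the extra factor the J-ladder starts with). [folklore] -/
theorem cube_le_of_scale {L x : ℝ} (hx0 : 0 ≤ x) (hx : x ≤ L⁻¹) : x ^ 3 ≤ L⁻¹ * x ^ 2 := by
  have _h := hx0
  have : x ^ 3 = x * x ^ 2 := by ring
  rw [this]
  exact mul_le_mul_of_nonneg_right hx (sq_nonneg x)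

/-- 0 ≤ x ≤ L⁻¹ < 1 ⇒ x³ ≤ x². [folklore] -/
theorem cube_le_sq_of_scale {L x : ℝ} (hL : 1 < L) (hx0 : 0 ≤ x) (hx : x ≤ L⁻¹) : x ^ 3 ≤ x ^ 2 := by
  have h1 : L⁻¹ < 1 := inv_lt_one_of_one_lt₀ hL
  calc x ^ 3 ≤ L⁻¹ * x ^ 2 := cube_le_of_scale hx0 hx
    _ ≤ 1 * x ^ 2 := mul_le_mul_of_nonneg_right h1.le (sq_nonneg x)
    _ = x ^ 2 := one_mul _

/-! ## §2  The DISPLAYED first-order ladder (3.41) → (3.44) → (3.46) → (1+6β) → (3.47) (pp. 278–279 [30–31])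

Schematic reals: `T₄₁` = ξ⁻²|∂ exp iξ𝐇_j(□₀, Q(…)) − 1|, `T₄₃` = ξ⁻²|∂ exp iξ𝐇_j(…) − 1 − iξ²∂^ξ𝐇_j(…)|, `D` = |∂^ξ𝐇_j(□₀,
Q(…))|, `T₄₅` = |∂^ξ𝐇_j(□₀, Q(…)) − ∂^ξH_{1,j}Q(…)|, `D₁` = |∂^ξH_{1,j}Q(…)|, `Dτ` = |∂^ξ𝐇_j(□₀, τQ(…))|, `E` = ξ⁻²|∂ exp
iξ𝐇_j(□₀, τQ(…)) − 1|; `htri` hypotheses are the triangle inequalities the text leaves implicit. -/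

/-- **(3.41) + (3.43) ⇒ (3.44)** p. 279 [31] *"The above inequality and (3.41) yield |∂^ξ𝐇_j(□₀, Q(L⁻¹η𝐇_{k+1}))| <
(1+4β)α₀(L^{j−1}η)² on □̃³. (3.44)"*: from ξ²|∂^ξ𝐇| ≤ |∂e^{iξ𝐇} − 1| + |∂e^{iξ𝐇} − 1 − iξ²∂^ξ𝐇|, (3.41) (1+3β), (3.43)
and the restriction *"(4B₃²O(1)M)²α₀ ≤ β"* (which turns the (3.43)-remainder (4B₃²O(1)M)²α₀²x² into βα₀x²).  Kernel-checked
arithmetic of the displayed step (`O₁` = the O(1)). [cite: Balaban1987RG1, (3.43)–(3.44) pp.278–279] -/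
theorem ineq344 {β α₀ B₃ O₁ M x D T₄₁ T₄₃ : ℝ} (hα₀ : 0 ≤ α₀)
    (hres : (4 * B₃ ^ 2 * O₁ * M) ^ 2 * α₀ ≤ β)
    (htri : D ≤ T₄₁ + T₄₃) (h41 : T₄₁ < (1 + 3 * β) * α₀ * x ^ 2)
    (h43 : T₄₃ < (4 * B₃ ^ 2 * O₁ * M) ^ 2 * α₀ ^ 2 * x ^ 2) :
    D < (1 + 4 * β) * α₀ * x ^ 2 := by
  have hax : 0 ≤ α₀ * x ^ 2 := mul_nonneg hα₀ (sq_nonneg x)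
  have h1 : (4 * B₃ ^ 2 * O₁ * M) ^ 2 * α₀ ^ 2 * x ^ 2 ≤ β * (α₀ * x ^ 2) := by
    calc (4 * B₃ ^ 2 * O₁ * M) ^ 2 * α₀ ^ 2 * x ^ 2
        = (4 * B₃ ^ 2 * O₁ * M) ^ 2 * α₀ * (α₀ * x ^ 2) := by ring
      _ ≤ β * (α₀ * x ^ 2) := mul_le_mul_of_nonneg_right hres hax
  have h2 : (1 + 3 * β) * α₀ * x ^ 2 + β * (α₀ * x ^ 2) = (1 + 4 * β) * α₀ * x ^ 2 := by ring
  linarith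

/-- The printed restriction absorbs any remainder constant below it: C ≤ (4B₃²O(1)M)² and (4B₃²O(1)M)²α₀ ≤ β give
Cα₀ ≤ β — the sense in which the J-ladder's constant C_N of (J1) *"would be absorbed into the generic O(1)"* (module
docstring (§3)). [folklore] -/
theorem resN_of_printed {C β α₀ B₃ O₁ M : ℝ} (hα₀ : 0 ≤ α₀) (hC : C ≤ (4 * B₃ ^ 2 * O₁ * M) ^ 2)
    (hres : (4 * B₃ ^ 2 * O₁ * M) ^ 2 * α₀ ≤ β) : C * α₀ ≤ β :=
  le_trans (mul_le_mul_of_nonneg_right hC hα₀) hres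

/-- **(3.45), inner inequality** p. 279 [31] *"< B₃(B₃O(1)Mα₀L^{j−1}η)² < βα₀(L^{j−1}η)²"*: it follows from the restriction
*"(4B₃²O(1)M)²α₀ ≤ β"* PROVIDED B₃ ≥ 1 (B₃ is the "sufficiently large" constant of [Balaban1985Variational] Prop. 9 —
the typed list `B12Sec2to5.Lemma4Restrictions` does not record B₃ ≥ 1, so it is a hypothesis here): B₃³O(1)²M²α₀ ≤
16B₃⁴O(1)²M²α₀ ≤ β.  Non-strict form. [cite: Balaban1987RG1, (3.45) p.279] -/
theorem ineq345_inner {β α₀ B₃ O₁ M x : ℝ} (hα₀ : 0 ≤ α₀) (hB : 1 ≤ B₃)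
    (hres : (4 * B₃ ^ 2 * O₁ * M) ^ 2 * α₀ ≤ β) :
    B₃ * (B₃ * O₁ * M * α₀ * x) ^ 2 ≤ β * α₀ * x ^ 2 := by
  have hax : 0 ≤ α₀ * x ^ 2 := mul_nonneg hα₀ (sq_nonneg x)
  have hOM : 0 ≤ (O₁ * M) ^ 2 * α₀ := mul_nonneg (sq_nonneg _) hα₀
  have hB0 : 0 ≤ B₃ ^ 3 := pow_nonneg (by linarith) 3
  have hB3 : B₃ ^ 3 ≤ 16 * B₃ ^ 4 := by
    have h' : 0 ≤ B₃ ^ 3 * (B₃ - 1) := mul_nonneg hB0 (by linarith)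
    nlinarith
  have h1 : B₃ ^ 3 * ((O₁ * M) ^ 2 * α₀) ≤ 16 * B₃ ^ 4 * ((O₁ * M) ^ 2 * α₀) :=
    mul_le_mul_of_nonneg_right hB3 hOM
  have h2 : 16 * B₃ ^ 4 * ((O₁ * M) ^ 2 * α₀) = (4 * B₃ ^ 2 * O₁ * M) ^ 2 * α₀ := by ring
  have h3 : B₃ ^ 3 * ((O₁ * M) ^ 2 * α₀) ≤ β := by linarith
  calc B₃ * (B₃ * O₁ * M * α₀ * x) ^ 2 = B₃ ^ 3 * ((O₁ * M) ^ 2 * α₀) * (α₀ * x ^ 2) := by ring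
    _ ≤ β * (α₀ * x ^ 2) := mul_le_mul_of_nonneg_right h3 hax
    _ = β * α₀ * x ^ 2 := by ring

/-- **(3.44) + (3.45) ⇒ (3.46)** p. 279 [31] *"Thus finally we obtain |∂^ξH_{1,j}Q(L⁻¹η𝐇_{k+1})| < (1+5β)α₀(L^{j−1}η)²
on □̃³. (3.46)"* (reverse triangle inequality |∂^ξH_{1,j}Q| ≤ |∂^ξ𝐇_j(Q)| + |difference|). [cite: Balaban1987RG1, (3.46) p.279] -/
theorem ineq346 {β α₀ x D D₁ T₄₅ : ℝ} (htri : D₁ ≤ D + T₄₅) (h44 : D < (1 + 4 * β) * α₀ * x ^ 2)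
    (h45 : T₄₅ < β * α₀ * x ^ 2) : D₁ < (1 + 5 * β) * α₀ * x ^ 2 := by
  have : (1 + 4 * β) * α₀ * x ^ 2 + β * α₀ * x ^ 2 = (1 + 5 * β) * α₀ * x ^ 2 := by ring
  linarith

/-- **τ-reversal** p. 279 [31] *"This inequality is linear in Q(…), hence it is valid also for this expression replaced
by τQ(…), τ ∈ [0, 1]. … we can reverse the arguments, thus we obtain (3.44) with τQ(…), and the factor 1+6β on the
right-hand side"*: |∂^ξ𝐇_j(τQ)| ≤ τ|∂^ξH_{1,j}Q| + |(≥ 2nd order part)(τQ)| < (1+5β)α₀x² + βα₀x². [cite: Balaban1987RG1, p.279 after (3.46)] -/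
theorem ineq344τ {β α₀ x τ D₁ Dτ T : ℝ} (hτ0 : 0 ≤ τ) (hτ1 : τ ≤ 1) (hD₁ : 0 ≤ D₁)
    (h46 : D₁ < (1 + 5 * β) * α₀ * x ^ 2) (h45τ : T < β * α₀ * x ^ 2) (htri : Dτ ≤ τ * D₁ + T) :
    Dτ < (1 + 6 * β) * α₀ * x ^ 2 := by
  have _h0 := hτ0
  have h1 : τ * D₁ ≤ D₁ := by nlinarith
  have : (1 + 5 * β) * α₀ * x ^ 2 + β * α₀ * x ^ 2 = (1 + 6 * β) * α₀ * x ^ 2 := by ring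
  linarith

/-- **(3.47)** p. 279 [31] *"Similarly, the inequality (3.43) yields |∂ exp iξ𝐇_j(□₀, τQ(L⁻¹η𝐇_{k+1}))| < (1+7β)α₀
(L^{j−1}η)²ξ² on □̃³. (3.47)"* [sic: "− 1" missing inside |·|]: (1+6β) + the (3.43)-remainder β under the restriction.
[cite: Balaban1987RG1, (3.47) p.279] -/
theorem ineq347 {β α₀ B₃ O₁ M x Dτ E T₄₃ : ℝ} (hα₀ : 0 ≤ α₀)
    (hres : (4 * B₃ ^ 2 * O₁ * M) ^ 2 * α₀ ≤ β)
    (htri : E ≤ Dτ + T₄₃) (h44τ : Dτ < (1 + 6 * β) * α₀ * x ^ 2)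
    (h43 : T₄₃ < (4 * B₃ ^ 2 * O₁ * M) ^ 2 * α₀ ^ 2 * x ^ 2) :
    E < (1 + 7 * β) * α₀ * x ^ 2 := by
  have hax : 0 ≤ α₀ * x ^ 2 := mul_nonneg hα₀ (sq_nonneg x)
  have h1 : (4 * B₃ ^ 2 * O₁ * M) ^ 2 * α₀ ^ 2 * x ^ 2 ≤ β * (α₀ * x ^ 2) := by
    calc (4 * B₃ ^ 2 * O₁ * M) ^ 2 * α₀ ^ 2 * x ^ 2
        = (4 * B₃ ^ 2 * O₁ * M) ^ 2 * α₀ * (α₀ * x ^ 2) := by ring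
      _ ≤ β * (α₀ * x ^ 2) := mul_le_mul_of_nonneg_right hres hax
  have h2 : (1 + 6 * β) * α₀ * x ^ 2 + β * (α₀ * x ^ 2) = (1 + 7 * β) * α₀ * x ^ 2 := by ring
  linarith

/-- The generic CLOSING step of both ladders, p. 279 [31] *"(1+7β)L⁻² ≤ 1 for β not too large"*: for any count c,
1 + cβ ≤ L² ⇒ (1 + cβ)L⁻²α₀ ≤ α₀ (`B12Sec2to5.ineq352_closes` is the case c = 8). [folklore] -/
theorem ladder_closes {L β α₀ c : ℝ} (hL : 0 < L) (hα₀ : 0 ≤ α₀) (hres : 1 + c * β ≤ L ^ 2) :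
    (1 + c * β) * L⁻¹ ^ 2 * α₀ ≤ α₀ := by
  have hL2 : 0 < L ^ 2 := by positivity
  have h1 : (1 + c * β) * L⁻¹ ^ 2 ≤ 1 := by
    rw [inv_pow, ← div_eq_mul_inv, div_le_one hL2]
    exact hres
  calc (1 + c * β) * L⁻¹ ^ 2 * α₀ ≤ 1 * α₀ := mul_le_mul_of_nonneg_right h1 hα₀
    _ = α₀ := one_mul _

/-- (3.47) ⇒ the first inequality of (iii) in the case B′ = 0 (p. 279: *"The above inequality is the required first
inequality in the condition (iii)"*): E < (1+7β)α₀x² ≤ (1+7β)L⁻²α₀ ≤ α₀ for 0 ≤ x ≤ L⁻¹ and 1 + 7β ≤ L².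
[cite: Balaban1987RG1, p.279 after (3.47)] -/
theorem ineq347_closes {L β α₀ x E : ℝ} (hL : 0 < L) (hα₀ : 0 ≤ α₀) (hβ : 0 ≤ β) (hx0 : 0 ≤ x) (hx : x ≤ L⁻¹)
    (hres7 : 1 + 7 * β ≤ L ^ 2) (h47 : E < (1 + 7 * β) * α₀ * x ^ 2) : E < α₀ := by
  have hx2 : x ^ 2 ≤ L⁻¹ ^ 2 := sq_le_of_scale hx0 hx
  have hc : 0 ≤ (1 + 7 * β) * α₀ := mul_nonneg (by linarith) hα₀
  have h1 : (1 + 7 * β) * α₀ * x ^ 2 ≤ (1 + 7 * β) * α₀ * L⁻¹ ^ 2 := mul_le_mul_of_nonneg_left hx2 hc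
  have h2 : (1 + 7 * β) * L⁻¹ ^ 2 * α₀ ≤ α₀ := ladder_closes hL hα₀ hres7
  have h3 : (1 + 7 * β) * α₀ * L⁻¹ ^ 2 = (1 + 7 * β) * L⁻¹ ^ 2 * α₀ := by ring
  linarith

/-! ## §3  The J-ladder: *"the same reasoning … for the second order operator ∂^{ξ*}∂^ξ"*, started at (3.42)

Schematic reals: `J₁` = the left member of (3.42) (τ = 1, B′ = 0), `P` = |∂^{ξ*}∂^ξ𝐇_j(□₀, Q(…))|, `P₁` = |∂^{ξ*}∂^ξ
H_{1,j}Q(…)|, `Pτ` = |∂^{ξ*}∂^ξ𝐇_j(□₀, τQ(…))|, `Pτ'` = |∂^{ξ*}∂^ξ𝐇_j(□₀, τQ(…) + B′)|, `J` = |𝐉| of the configuration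
exp iξ𝐇_j(□₀, τQ(…) + B′) (the orbit representative of p. 277), `b` = |B′|; INPUTS (hypotheses, NOT displayed in print):
(J1) `N` ≤ C·α₀²·x² — the J-linearisation remainder |𝐉(exp iξ𝐇) − ∂^{ξ*}∂^ξ𝐇| at Q(…) (B′ = 0, the (3.43)-analogue) —
and (J1′) `N'` ≤ βL⁻²α₀ — the same remainder at τQ(…) + B′ (the analogue of *"(3.43) slightly modified for the present
situation"*: one β at the scale L⁻²);
(J2) `S`, `Sτ` < βα₀x² — the (3.45)-analogue for ∂^{ξ*}∂^ξ at Q(…) and at τQ(…); (J3) `A` ≤ B₃″·|B′| — a second-derivative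
bound on 𝐀₂ of (3.50); restrictions C·α₀ ≤ β and B₃″α₃ ≤ βL⁻²α₀ (printed SHAPES, not in the printed list). -/

/-- J-rung 1 (the honest form of *"a bound of the type (3.44), but for the second order operator"*): from the PRINTED
(3.42) |𝐉₁| < (1+3β)α₀x³ and the input (J1) N ≤ Cα₀²x² with Cα₀ ≤ β: |∂^{ξ*}∂^ξ𝐇_j(□₀, Q(…))| < (1+3β)α₀x³ + βα₀x² —
an x³-term plus an x²-term, NOT (1+4β)α₀x³ (§4).  Elementary arithmetic about hypotheses; only (3.42) is printed.
[folklore] -/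
theorem jineq344 {β α₀ C x P J₁ N : ℝ} (hα₀ : 0 ≤ α₀) (hresN : C * α₀ ≤ β)
    (htri : P ≤ J₁ + N) (h42 : J₁ < (1 + 3 * β) * α₀ * x ^ 3) (hN : N ≤ C * α₀ ^ 2 * x ^ 2) :
    P < (1 + 3 * β) * α₀ * x ^ 3 + β * α₀ * x ^ 2 := by
  have hax : 0 ≤ α₀ * x ^ 2 := mul_nonneg hα₀ (sq_nonneg x)
  have h1 : C * α₀ ^ 2 * x ^ 2 ≤ β * (α₀ * x ^ 2) := by
    calc C * α₀ ^ 2 * x ^ 2 = C * α₀ * (α₀ * x ^ 2) := by ring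
      _ ≤ β * (α₀ * x ^ 2) := mul_le_mul_of_nonneg_right hresN hax
  have h2 : β * (α₀ * x ^ 2) = β * α₀ * x ^ 2 := by ring
  linarith

/-- J-rung 2 (the (3.45)/(3.46)-analogue): with the input (J2) S < βα₀x² for the ≥ 2nd-order part of 𝐇_j = H_{1,j}B + …
((174) of [Balaban1985Variational], quoted on p. 279) under ∂^{ξ*}∂^ξ: |∂^{ξ*}∂^ξH_{1,j}Q(…)| < (1+3β)α₀x³ + 2βα₀x².
[folklore] -/
theorem jineq346 {β α₀ x P P₁ S : ℝ} (htri : P₁ ≤ P + S) (hP : P < (1 + 3 * β) * α₀ * x ^ 3 + β * α₀ * x ^ 2)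
    (hS : S < β * α₀ * x ^ 2) : P₁ < (1 + 3 * β) * α₀ * x ^ 3 + 2 * β * α₀ * x ^ 2 := by
  linarith

/-- J-rung 3 (the τ-reversal, linearity of ∂^{ξ*}∂^ξH_{1,j}(τQ) = τ∂^{ξ*}∂^ξH_{1,j}Q in τ ∈ [0, 1], + (J2) at τQ):
|∂^{ξ*}∂^ξ𝐇_j(□₀, τQ(…))| < (1+3β)α₀x³ + 3βα₀x². [folklore] -/
theorem jineq344τ {β α₀ x τ P₁ Pτ Sτ : ℝ} (hτ0 : 0 ≤ τ) (hτ1 : τ ≤ 1) (hP₁ : 0 ≤ P₁)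
    (h46 : P₁ < (1 + 3 * β) * α₀ * x ^ 3 + 2 * β * α₀ * x ^ 2) (hSτ : Sτ < β * α₀ * x ^ 2)
    (htri : Pτ ≤ τ * P₁ + Sτ) : Pτ < (1 + 3 * β) * α₀ * x ^ 3 + 3 * β * α₀ * x ^ 2 := by
  have _h0 := hτ0
  have h1 : τ * P₁ ≤ P₁ := by nlinarith
  linarith

/-- J-rung 4 (the (3.51)-analogue, B′ ≠ 0): with the input (J3) |∂^{ξ*}∂^ξ𝐀₂| ≤ B₃″|B′|, B₃″ ≥ 0 and |B′| < α₃: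
|∂^{ξ*}∂^ξ𝐇_j(□₀, τQ(…) + B′)| < (1+3β)α₀x³ + 3βα₀x² + B₃″α₃.  (p. 280 displays only the FIRST-order |𝐀₂|, |∇^ξ𝐀₂| ≤
B₃|B′|, which is what (3.51) needs; the J-half needs a second derivative of 𝐀₂.) [folklore] -/
theorem jineq351 {β α₀ x B₃'' α₃ b Pτ Pτ' A : ℝ} (hB'' : 0 ≤ B₃'') (hb : b < α₃) (hA : A ≤ B₃'' * b)
    (h44τ : Pτ < (1 + 3 * β) * α₀ * x ^ 3 + 3 * β * α₀ * x ^ 2) (htri : Pτ' ≤ Pτ + A) :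
    Pτ' < (1 + 3 * β) * α₀ * x ^ 3 + 3 * β * α₀ * x ^ 2 + B₃'' * α₃ := by
  have h1 : B₃'' * b ≤ B₃'' * α₃ := mul_le_mul_of_nonneg_left hb.le hB''
  linarith

/-- J-rung 5 (the (3.52)-analogue: back from ∂^{ξ*}∂^ξ𝐇 to 𝐉 with the input (J1′) at τQ(…) + B′, the analogue of
*"(3.43) slightly modified for the present situation"* — one β at the scale L⁻², as (3.51) → (3.52)):
|𝐉| < (1+3β)α₀x³ + 3βα₀x² + B₃″α₃ + βL⁻²α₀ =: the J-BUDGET. [folklore] -/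
theorem jineq352 {β α₀ L x B₃'' α₃ Pτ' N' J : ℝ}
    (h51 : Pτ' < (1 + 3 * β) * α₀ * x ^ 3 + 3 * β * α₀ * x ^ 2 + B₃'' * α₃) (hN' : N' ≤ β * L⁻¹ ^ 2 * α₀)
    (htri : J ≤ Pτ' + N') :
    J < (1 + 3 * β) * α₀ * x ^ 3 + 3 * β * α₀ * x ^ 2 + B₃'' * α₃ + β * L⁻¹ ^ 2 * α₀ := by
  linarith

/-- **The J-ladder composed** (rungs 1–5): from the printed (3.42) and the inputs (J1), (J1′), (J2)×2, (J3) with the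
implicit triangle inequalities, for τ ∈ [0, 1] and |B′| < α₃: |𝐉| < (1+3β)α₀x³ + 3βα₀x² + B₃″α₃ + βL⁻²α₀ =: the
J-BUDGET.  Every hypothesis except `h42` is an input NOT displayed in [Balaban1987RG1]. [folklore] -/
theorem jLadder_bound {β α₀ L C B₃'' α₃ x τ b J₁ N P S P₁ Sτ Pτ A Pτ' N' J : ℝ}
    (hα₀ : 0 ≤ α₀) (hB'' : 0 ≤ B₃'') (hresN : C * α₀ ≤ β) (hτ0 : 0 ≤ τ) (hτ1 : τ ≤ 1) (hb : b < α₃)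
    (h42 : J₁ < (1 + 3 * β) * α₀ * x ^ 3)
    (hN : N ≤ C * α₀ ^ 2 * x ^ 2) (htri₁ : P ≤ J₁ + N)
    (hS : S < β * α₀ * x ^ 2) (htri₂ : P₁ ≤ P + S) (hP₁ : 0 ≤ P₁)
    (hSτ : Sτ < β * α₀ * x ^ 2) (htri₃ : Pτ ≤ τ * P₁ + Sτ)
    (hA : A ≤ B₃'' * b) (htri₄ : Pτ' ≤ Pτ + A)
    (hN' : N' ≤ β * L⁻¹ ^ 2 * α₀) (htri₅ : J ≤ Pτ' + N') :
    J < (1 + 3 * β) * α₀ * x ^ 3 + 3 * β * α₀ * x ^ 2 + B₃'' * α₃ + β * L⁻¹ ^ 2 * α₀ :=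
  jineq352
    (jineq351 hB'' hb hA (jineq344τ hτ0 hτ1 hP₁ (jineq346 htri₂ (jineq344 hα₀ hresN htri₁ h42 hN) hS) hSτ htri₃) htri₄)
    hN' htri₅

/-- **The J-budget fits inside α₀, strictly**, under the printed-shape restrictions: for 1 < L, 0 < α₀, 0 ≤ β, 0 ≤ x ≤ L⁻¹,
B₃″α₃ ≤ βL⁻²α₀ and 1 + 8β ≤ L²:  (1+3β)α₀x³ + 3βα₀x² + B₃″α₃ + βL⁻²α₀ ≤ (1+3β)L⁻¹·α₀L⁻² + 3βα₀L⁻² + βL⁻²α₀ + βL⁻²α₀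
< (1+8β)L⁻²α₀ ≤ α₀ — the SAME count 1+8β as the first-order ladder's (3.52); strictness from L⁻¹ < 1 on the x³-start.
[folklore] -/
theorem jBudget_lt {β α₀ L x B₃'' α₃ : ℝ} (hL : 1 < L) (hα₀ : 0 < α₀) (hβ : 0 ≤ β) (hx0 : 0 ≤ x) (hx : x ≤ L⁻¹)
    (hres'' : B₃'' * α₃ ≤ β * L⁻¹ ^ 2 * α₀) (hres8 : 1 + 8 * β ≤ L ^ 2) :
    (1 + 3 * β) * α₀ * x ^ 3 + 3 * β * α₀ * x ^ 2 + B₃'' * α₃ + β * L⁻¹ ^ 2 * α₀ < α₀ := by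
  have hLpos : 0 < L := by linarith
  have hLinv : L⁻¹ < 1 := inv_lt_one_of_one_lt₀ hL
  have hLinv0 : 0 < L⁻¹ := inv_pos.mpr hLpos
  have hLinv2 : 0 < L⁻¹ ^ 2 := pow_pos hLinv0 2
  have hx2 : x ^ 2 ≤ L⁻¹ ^ 2 := sq_le_of_scale hx0 hx
  have hx3 : x ^ 3 ≤ L⁻¹ * x ^ 2 := cube_le_of_scale hx0 hx
  have hc : 0 < (1 + 3 * β) * α₀ := mul_pos (by linarith) hα₀
  have s1 : (1 + 3 * β) * α₀ * x ^ 3 ≤ (1 + 3 * β) * α₀ * (L⁻¹ * x ^ 2) :=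
    mul_le_mul_of_nonneg_left hx3 hc.le
  have s2 : (1 + 3 * β) * α₀ * (L⁻¹ * x ^ 2) ≤ (1 + 3 * β) * α₀ * (L⁻¹ * L⁻¹ ^ 2) :=
    mul_le_mul_of_nonneg_left (mul_le_mul_of_nonneg_left hx2 hLinv0.le) hc.le
  have s3 : (1 + 3 * β) * α₀ * (L⁻¹ * L⁻¹ ^ 2) < (1 + 3 * β) * α₀ * L⁻¹ ^ 2 := by
    have h' : L⁻¹ * L⁻¹ ^ 2 < 1 * L⁻¹ ^ 2 := mul_lt_mul_of_pos_right hLinv hLinv2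
    rw [one_mul] at h'
    exact mul_lt_mul_of_pos_left h' hc
  have h3β : 0 ≤ 3 * β * α₀ := mul_nonneg (mul_nonneg (by norm_num) hβ) hα₀.le
  have s4 : 3 * β * α₀ * x ^ 2 ≤ 3 * β * α₀ * L⁻¹ ^ 2 := mul_le_mul_of_nonneg_left hx2 h3β
  have s5 : (1 + 8 * β) * L⁻¹ ^ 2 * α₀ ≤ α₀ := B12Sec2to5.ineq352_closes hLpos hα₀.le hres8
  have e : (1 + 3 * β) * α₀ * L⁻¹ ^ 2 + 3 * β * α₀ * L⁻¹ ^ 2 + β * L⁻¹ ^ 2 * α₀ + β * L⁻¹ ^ 2 * α₀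
      = (1 + 8 * β) * L⁻¹ ^ 2 * α₀ := by ring
  linarith

/-- **The J-half closes**: any J below the J-budget is < α₀ under the restrictions of `jBudget_lt`. [folklore] -/
theorem jHalf_closes {β α₀ L x B₃'' α₃ J : ℝ} (hL : 1 < L) (hα₀ : 0 < α₀) (hβ : 0 ≤ β) (hx0 : 0 ≤ x)
    (hx : x ≤ L⁻¹) (hres'' : B₃'' * α₃ ≤ β * L⁻¹ ^ 2 * α₀) (hres8 : 1 + 8 * β ≤ L ^ 2)
    (hJ : J < (1 + 3 * β) * α₀ * x ^ 3 + 3 * β * α₀ * x ^ 2 + B₃'' * α₃ + β * L⁻¹ ^ 2 * α₀) : J < α₀ :=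
  lt_trans hJ (jBudget_lt hL hα₀ hβ hx0 hx hres'' hres8)

/-- **Second inequality of (iii) for the composite configuration, over the typed constants of Lemma 4**: under EXACTLY
`B12Sec2to5.Lemma4Restrictions c` (*"all the restrictions"*, pp. 276–280) plus the ONE unlisted restriction
B₃″α₃ ≤ βL⁻²α₀ on the second-derivative constant of (J3), at any scale 1 ≤ j with L^jη ≤ 1 (p. 279 *"j ≤ k, hence
L^jη ≤ 1"*): a J below the J-budget at x = L^{j−1}η satisfies |𝐉| < α₀ = γ₀, i.e. the second inequality of (1.14)/(iii)
for U^c_j(X, α₀, α₁).  (The remainder restriction C_N·α₀ ≤ β of (J1) is consumed upstream, in `jLadder_bound`; the J-budget is the bound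
`jLadder_bound` delivers.)
[folklore] -/
theorem condIII_second_of_restrictions (c : B12Sec2to5.Lemma4Consts) (hR : B12Sec2to5.Lemma4Restrictions c)
    {B₃'' η J : ℝ} {j : ℕ} (hη : 0 ≤ η) (hj : 1 ≤ j) (hscale : c.L ^ j * η ≤ 1)
    (hres'' : B₃'' * c.α₃ ≤ c.β * c.L⁻¹ ^ 2 * c.α₀)
    (hJ : J < (1 + 3 * c.β) * c.α₀ * (c.L ^ (j - 1) * η) ^ 3 + 3 * c.β * c.α₀ * (c.L ^ (j - 1) * η) ^ 2
      + B₃'' * c.α₃ + c.β * c.L⁻¹ ^ 2 * c.α₀) :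
    J < c.α₀ := by
  unfold B12Sec2to5.Lemma4Restrictions at hR
  obtain ⟨hα₀, _, _, _, hβ, _, _, hL1, _, _, _, _, _, hres8⟩ := hR
  have hLpos : 0 < c.L := by linarith
  exact jHalf_closes hL1 hα₀ hβ.le (scale_nonneg j hLpos hη) (scale_le hLpos hη hj hscale) hres'' hres8 hJ

/-- **End-to-end, from the inputs**: the printed (3.42) + the inputs (J1), (J1′), (J2)×2, (J3) (+ triangle inequalities) +
`Lemma4Restrictions c` + the two unlisted printed-shape restrictions (C·α₀ ≤ β, B₃″α₃ ≤ βL⁻²α₀) ⇒ |𝐉| < α₀ for every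
τ ∈ [0, 1], |B′| < α₃, 1 ≤ j, L^jη ≤ 1 — the J-half of (3.36)/(3.53) in the shape the census (GAPS G-B12s-07, C-adv2-32)
records as derivable but not displayed. [folklore] -/
theorem condIII_second_of_inputs (c : B12Sec2to5.Lemma4Consts) (hR : B12Sec2to5.Lemma4Restrictions c)
    {C B₃'' η τ b J₁ N P S P₁ Sτ Pτ A Pτ' N' J : ℝ} {j : ℕ}
    (hη : 0 ≤ η) (hj : 1 ≤ j) (hscale : c.L ^ j * η ≤ 1)
    (hB'' : 0 ≤ B₃'') (hresN : C * c.α₀ ≤ c.β) (hres'' : B₃'' * c.α₃ ≤ c.β * c.L⁻¹ ^ 2 * c.α₀)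
    (hτ0 : 0 ≤ τ) (hτ1 : τ ≤ 1) (hb : b < c.α₃)
    (h42 : J₁ < (1 + 3 * c.β) * c.α₀ * (c.L ^ (j - 1) * η) ^ 3)
    (hN : N ≤ C * c.α₀ ^ 2 * (c.L ^ (j - 1) * η) ^ 2) (htri₁ : P ≤ J₁ + N)
    (hS : S < c.β * c.α₀ * (c.L ^ (j - 1) * η) ^ 2) (htri₂ : P₁ ≤ P + S) (hP₁ : 0 ≤ P₁)
    (hSτ : Sτ < c.β * c.α₀ * (c.L ^ (j - 1) * η) ^ 2) (htri₃ : Pτ ≤ τ * P₁ + Sτ)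
    (hA : A ≤ B₃'' * b) (htri₄ : Pτ' ≤ Pτ + A)
    (hN' : N' ≤ c.β * c.L⁻¹ ^ 2 * c.α₀) (htri₅ : J ≤ Pτ' + N') :
    J < c.α₀ := by
  have hα₀ : 0 < c.α₀ := by
    unfold B12Sec2to5.Lemma4Restrictions at hR
    exact hR.1
  exact condIII_second_of_restrictions c hR hη hj hscale hres''
    (jLadder_bound hα₀.le hB'' hresN hτ0 hτ1 hb h42 hN htri₁ hS htri₂ hP₁ hSτ htri₃ hA htri₄ hN' htri₅)

/-! ## §4  No x³-scale ("type (3.44)") form of J-rung 1 UNDER THE (J1) SHAPE TYPED HERE (v1.1 hedge: a fact about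
the typed remainder shape N ≤ C·α₀²·x², not about a printed display — see the module docstring (§4) CAVEAT) -/

/-- **`no_x3_form`** (the kernel witness offered for GAPS G-adv2-28 (i) — UNDER THE (J1) SHAPE TYPED HERE, N ≤ C·α₀²·x²;
v1.1 hedge per XREAD C-adv4-75 A2: if the undisplayed J-remainder carries a further small factor, e.g. another power of
x, this witness does not apply to it): for every C > 0 (remainder constant of (J1)), every
α₀ > 0, β ≥ 0 and L > 0 there is an ADMISSIBLE scale value x ∈ (0, L⁻¹] (every such x is L^{j−1}η for j = 1, η = x ≤ L⁻¹,
and small x means k − j large) with βx < Cα₀ — so the requirement C·α₀ ≤ β·x, which is what fitting the (J1)-remainder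
C·α₀²·x² under β·α₀·x³ (an x³-scale *"bound of the type (3.44)"* with constant (1+4β)) would need at EVERY admissible
scale, fails.  (Re-proof, for L > 0 instead of L ≥ 2, of `Adv2G20.no_x3_form` of the adversarial reader's second engine.)
[folklore] -/
theorem no_x3_form {C α₀ β L : ℝ} (hC : 0 < C) (hα₀ : 0 < α₀) (hβ : 0 ≤ β) (hL : 0 < L) :
    ∃ x : ℝ, 0 < x ∧ x ≤ L⁻¹ ∧ β * x < C * α₀ := by
  refine ⟨min L⁻¹ (C * α₀ / (2 * (β + 1))), lt_min (inv_pos.mpr hL) (by positivity), min_le_left _ _, ?_⟩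
  have hm : min L⁻¹ (C * α₀ / (2 * (β + 1))) ≤ C * α₀ / (2 * (β + 1)) := min_le_right _ _
  have hpos : 0 < C * α₀ := mul_pos hC hα₀
  calc β * min L⁻¹ (C * α₀ / (2 * (β + 1)))
      ≤ β * (C * α₀ / (2 * (β + 1))) := mul_le_mul_of_nonneg_left hm hβ
    _ = C * α₀ * (β / (2 * (β + 1))) := by ring
    _ < C * α₀ * 1 := by
        apply mul_lt_mul_of_pos_left _ hpos
        rw [div_lt_one (by positivity)]
        linarith
    _ = C * α₀ := mul_one _

/-- **No uniform x³-budget for the (J1)-remainder**: it is impossible that C·α₀²·x² ≤ β·α₀·x³ holds at every admissible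
scale value x ∈ (0, L⁻¹] (C > 0, α₀ > 0, β ≥ 0, L > 0) — the precise sense in which, UNDER THE (J1) SHAPE TYPED HERE
(no further small factor in the remainder; v1.1 hedge, XREAD C-adv4-75 A2), *"a bound of the type (3.44), but for
the second order operator"* is not what *"the same way"* gives; `jineq344` (an x³-term PLUS a βα₀x²-term) is.
[folklore] -/
theorem not_x3_budget {C α₀ β L : ℝ} (hC : 0 < C) (hα₀ : 0 < α₀) (hβ : 0 ≤ β) (hL : 0 < L) :
    ¬ (∀ x : ℝ, 0 < x → x ≤ L⁻¹ → C * α₀ ^ 2 * x ^ 2 ≤ β * α₀ * x ^ 3) := by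
  intro h
  obtain ⟨x, hx0, hxL, hlt⟩ := no_x3_form hC hα₀ hβ hL
  have h1 := h x hx0 hxL
  have hax : 0 < α₀ * x ^ 2 := mul_pos hα₀ (pow_pos hx0 2)
  have h2 : β * α₀ * x ^ 3 < C * α₀ ^ 2 * x ^ 2 := by
    calc β * α₀ * x ^ 3 = β * x * (α₀ * x ^ 2) := by ring
      _ < C * α₀ * (α₀ * x ^ 2) := mul_lt_mul_of_pos_right hlt hax
      _ = C * α₀ ^ 2 * x ^ 2 := by ring
  linarith

/-- By contrast the FIRST-order budget is scale-free: the printed restriction *"(4B₃²O(1)M)²α₀ ≤ β"* fits the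
(3.43)-remainder under βα₀x² at EVERY x (this is `ineq344`'s step `h1`), which is why the displayed chain works at the
x²-scale and the analogy silently changes scale one derivative up. [folklore] -/
theorem first_order_budget_uniform {β α₀ B₃ O₁ M : ℝ} (hα₀ : 0 ≤ α₀)
    (hres : (4 * B₃ ^ 2 * O₁ * M) ^ 2 * α₀ ≤ β) :
    ∀ x : ℝ, (4 * B₃ ^ 2 * O₁ * M) ^ 2 * α₀ ^ 2 * x ^ 2 ≤ β * α₀ * x ^ 2 := by
  intro x
  have hax : 0 ≤ α₀ * x ^ 2 := mul_nonneg hα₀ (sq_nonneg x)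
  calc (4 * B₃ ^ 2 * O₁ * M) ^ 2 * α₀ ^ 2 * x ^ 2
      = (4 * B₃ ^ 2 * O₁ * M) ^ 2 * α₀ * (α₀ * x ^ 2) := by ring
    _ ≤ β * (α₀ * x ^ 2) := mul_le_mul_of_nonneg_right hres hax
    _ = β * α₀ * x ^ 2 := by ring

/-! ## §5  Both inequalities of (iii) for the composite configuration; the τ = 1, B′ = 0 case -/

/-- At τ = 1, B′ = 0 the PRINTED (3.42) alone already gives the second inequality of (iii), with no expansion:
|𝐉₁| < (1+3β)α₀x³ ≤ (1+3β)α₀L⁻³ < α₀ (1 < L, 1 + 8β ≤ L²) — an observation about the printed bound (3.42) p. 278, not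
a printed sentence. [folklore] -/
theorem ineq342_closes {β α₀ L x J₁ : ℝ} (hL : 1 < L) (hα₀ : 0 < α₀) (hβ : 0 ≤ β) (hx0 : 0 ≤ x) (hx : x ≤ L⁻¹)
    (hres8 : 1 + 8 * β ≤ L ^ 2) (h42 : J₁ < (1 + 3 * β) * α₀ * x ^ 3) : J₁ < α₀ := by
  have hLpos : 0 < L := by linarith
  have h0 : (0 : ℝ) * 0 ≤ β * L⁻¹ ^ 2 * α₀ := by
    rw [mul_zero]
    exact mul_nonneg (mul_nonneg hβ (sq_nonneg _)) hα₀.le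
  have hb := jBudget_lt (B₃'' := 0) (α₃ := 0) hL hα₀ hβ hx0 hx h0 hres8
  have h3 : 0 ≤ 3 * β * α₀ * x ^ 2 := mul_nonneg (mul_nonneg (mul_nonneg (by norm_num) hβ) hα₀.le) (sq_nonneg x)
  have h5 : 0 ≤ β * L⁻¹ ^ 2 * α₀ := mul_nonneg (mul_nonneg hβ (sq_nonneg _)) hα₀.le
  have _hL := hLpos
  linarith

/-- **Condition (iii), both inequalities, for the composite configuration** under `Lemma4Restrictions c` + the unlisted
B₃″-restriction: the first inequality's constant closes ((3.52): (1+8β)L⁻²α₀ ≤ α₀, `B12Sec2to5.ineq352_closes`) and any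
J below the J-budget is < α₀ (§3).  Kernel bookkeeping of p. 280 *"This implies the first inequality in the condition
(iii). The second is proved in the same way, as it was already discussed."* — the second half with its inputs explicit.
[folklore] -/
theorem condIII_both_of_restrictions (c : B12Sec2to5.Lemma4Consts) (hR : B12Sec2to5.Lemma4Restrictions c)
    {B₃'' η J : ℝ} {j : ℕ} (hη : 0 ≤ η) (hj : 1 ≤ j) (hscale : c.L ^ j * η ≤ 1)
    (hres'' : B₃'' * c.α₃ ≤ c.β * c.L⁻¹ ^ 2 * c.α₀)
    (hJ : J < (1 + 3 * c.β) * c.α₀ * (c.L ^ (j - 1) * η) ^ 3 + 3 * c.β * c.α₀ * (c.L ^ (j - 1) * η) ^ 2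
      + B₃'' * c.α₃ + c.β * c.L⁻¹ ^ 2 * c.α₀) :
    (1 + 8 * c.β) * c.L⁻¹ ^ 2 * c.α₀ ≤ c.α₀ ∧ J < c.α₀ := by
  refine ⟨?_, condIII_second_of_restrictions c hR hη hj hscale hres'' hJ⟩
  unfold B12Sec2to5.Lemma4Restrictions at hR
  obtain ⟨hα₀, _, _, _, _, _, _, hL1, _, _, _, _, _, hres8⟩ := hR
  exact B12Sec2to5.ineq352_closes (by linarith) hα₀.le hres8

end Literature.MathematicalPhysics.QuantumFieldTheory.Balaban1983to89.B12CondIIIJ
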